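import Summits.ValiantsHypothesis.ValiantsHypothesis.Theorems.LacunarySymmetroidMatrixDescartesDoorA26WallBubblingChainCeiling

/-!
# Wall bubbling for `DoorA26` — (W-split) structure, part B0: THE EQUALITY CASE OF THE CHAIN CEILING, and Sidon bookkeeping at a generic Weyl face

HONEST FRAMING.  Arithmetic / bookkeeping lemmas for obligation (W) `stub_weylFaces` of `Cruxes/DoorA26/Lines/wall_bubbling.lean`
(stmt-ValiantsHypothesis-19979 `DoorA26`; OPEN, typed, never asserted), W2 seat val-sym-door-p1 g15; named residual «(W-split) multi-scale linking» of
`Cruxes/DoorA26/Lines/wall_bubbling_ConfluentDoor.lean` rev 4.  Consumed by the tight-chain structure theorem (`…WallBubblingTightChain.tightChain`).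

* `chain_ceiling_tight` — THE EQUALITY CASE of the count #17 `chain_ceiling`: if the total zero count reaches the ceiling `Σ_w (n w − 1) + (|V| − 1)`,
  then every cluster count is sharp (`m c + 1 = Σ_{Λ c}(d + 1)`), every value's confluent degrees are shared out exactly (`Σ_c [w ∈ Λ c] d c w = n w − 1`),
  and the interval count is tight (`Σ_c (|Λ c| − 1) = |V| − 1`);
* `sum_le_one_of_pairwise`, `sum_le_two_of_rules` — the two finite sums behind slot splitting (a doubleton `t`-slot alive in two clusters is
  forbidden ⇒ `Σ ≤ 1`; a `t²`-slot kills all other triple degrees and no three clusters carry the triple `t`-slot ⇒ `Σ ≤ 2`);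
* `weyl_pos_inj`, `weyl_singleton_value`, `weyl_triple_value` — 2-Sidon bookkeeping at a generic Weyl face (positions `0, 5`): which members can
  share a value with a confluent member.

No new definitions; nothing here bears on `DoorA26`, `MatrixDescartes` (stmt-ValiantsHypothesis-18050) or `VP ≠ VNP`; (W)/(W-split)/`ConfluentDoor26` OPEN.

[folklore] double counting, equality cases; Sidon sets.  [this work] the bookkeeping.
-/

-- `Summit.ValiantsHypothesis.ValiantsHypothesis.…` repeats a component by the D-0017 layout
-- (single-conjunct summit), which the `dupNamespace` linter flags; the name is mandated.
set_option linter.dupNamespace false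

namespace Summit.ValiantsHypothesis.ValiantsHypothesis.Theorems.LacunarySymmetroidMatrixDescartes.WallBubbling

open Finset
open scoped BigOperators

/-! ## 1. Arithmetic: the equality case of the chain ceiling, and two small sums -/

/-- **THE CHAIN CEILING, EQUALITY CASE.**  Under the hypotheses of `chain_ceiling` (#17), if the total zero count reaches the ceiling
`Σ_w (n w − 1) + (|V| − 1)` then every intermediate inequality is an equality: each cluster count is sharp, each value's degrees are shared out
exactly, and the interval count is tight. [this work] -/
theorem chain_ceiling_tight (V : Finset ℝ) (n : ℝ → ℕ) {C : ℕ} (Λ : Fin C → Finset ℝ) (d : Fin C → ℝ → ℕ) (m : Fin C → ℕ)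
    (hne : ∀ c, (Λ c).Nonempty) (hsub : ∀ c, Λ c ⊆ V)
    (hmono : ∀ c c', c < c' → ∀ w ∈ Λ c, ∀ w' ∈ Λ c', w ≤ w')
    (hsplit : ∀ w ∈ V, (∑ c, if w ∈ Λ c then d c w else 0) ≤ n w - 1)
    (hcount : ∀ c, m c + 1 ≤ ∑ w ∈ Λ c, (d c w + 1))
    (htot : ∑ w ∈ V, (n w - 1) + (V.card - 1) ≤ ∑ c, m c) :
    (∀ c, m c + 1 = ∑ w ∈ Λ c, (d c w + 1)) ∧
    (∀ w ∈ V, (∑ c, if w ∈ Λ c then d c w else 0) = n w - 1) ∧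
    (∑ c, ((Λ c).card - 1) = V.card - 1) := by
  classical
  have h1 : ∀ c, m c ≤ (∑ w ∈ Λ c, d c w) + ((Λ c).card - 1) := by
    intro c
    have hc := hcount c
    rw [Finset.sum_add_distrib, Finset.sum_const, smul_eq_mul, mul_one] at hc
    have hcard : 1 ≤ (Λ c).card := Finset.card_pos.mpr (hne c)
    omega
  have h2 : ∑ c, ∑ w ∈ Λ c, d c w = ∑ w ∈ V, ∑ c, (if w ∈ Λ c then d c w else 0) := by
    rw [Finset.sum_comm]
    refine Finset.sum_congr rfl fun c _ => ?_
    rw [← Finset.sum_filter]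
    congr 1
    ext w
    simp only [Finset.mem_filter]
    exact ⟨fun h => ⟨hsub c h, h⟩, fun h => h.2⟩
  have h3 : ∑ w ∈ V, ∑ c, (if w ∈ Λ c then d c w else 0) ≤ ∑ w ∈ V, (n w - 1) := Finset.sum_le_sum hsplit
  have h4 : ∑ c, ((Λ c).card - 1) ≤ V.card - 1 := Bubbling.interval_count V Λ hne hsub hmono
  have hXY : ∑ c, m c ≤ (∑ c, ∑ w ∈ Λ c, d c w) + ∑ c, ((Λ c).card - 1) := by
    rw [← Finset.sum_add_distrib]; exact Finset.sum_le_sum fun c _ => h1 c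
  have hXP : (∑ c, ∑ w ∈ Λ c, d c w) ≤ ∑ w ∈ V, (n w - 1) := by rw [h2]; exact h3
  have hA : ∑ c, m c = (∑ c, ∑ w ∈ Λ c, d c w) + ∑ c, ((Λ c).card - 1) := by omega
  have hX : (∑ c, ∑ w ∈ Λ c, d c w) = ∑ w ∈ V, (n w - 1) := by omega
  have hY : ∑ c, ((Λ c).card - 1) = V.card - 1 := by omega
  refine ⟨?_, ?_, hY⟩
  · rw [← Finset.sum_add_distrib] at hA
    have hterm := (Finset.sum_eq_sum_iff_of_le (fun c _ => h1 c)).mp hA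
    intro c
    have hc := hterm c (Finset.mem_univ c)
    rw [Finset.sum_add_distrib, Finset.sum_const, smul_eq_mul, mul_one]
    have hcard : 1 ≤ (Λ c).card := Finset.card_pos.mpr (hne c)
    omega
  · rw [h2] at hX
    exact fun w hw => (Finset.sum_eq_sum_iff_of_le hsplit).mp hX w hw

/-- A `{0,1}`-valued function on `Fin C` with no two distinct ones sums to at most `1`. [folklore] -/
theorem sum_le_one_of_pairwise {C : ℕ} (f : Fin C → ℕ) (h1 : ∀ c, f c ≤ 1)
    (h2 : ∀ c c', c < c' → f c = 1 → f c' = 1 → False) : ∑ c, f c ≤ 1 := by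
  classical
  have hf : ∀ c, f c = if f c = 1 then 1 else 0 := by
    intro c; have := h1 c; split_ifs with h <;> omega
  rw [Finset.sum_congr rfl (fun c _ => hf c), Finset.sum_boole, Nat.cast_id]
  refine Finset.card_le_one.mpr fun a ha b hb => ?_
  rw [Finset.mem_filter] at ha hb
  by_contra hab
  rcases lt_or_gt_of_ne hab with h | h
  · exact h2 a b h ha.2 hb.2
  · exact h2 b a h hb.2 ha.2

/-- A `{0,1,2}`-valued function on `Fin C` in which a `2` kills every other value and no three increasing indices carry ones sums to at most `2`.
[folklore] -/
theorem sum_le_two_of_rules {C : ℕ} (f : Fin C → ℕ) (h2 : ∀ c, f c ≤ 2)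
    (hA : ∀ c c', c ≠ c' → f c = 2 → f c' = 0)
    (hB : ∀ c₁ c₂ c₃, c₁ < c₂ → c₂ < c₃ → f c₁ = 1 → f c₂ = 1 → f c₃ = 1 → False) : ∑ c, f c ≤ 2 := by
  classical
  by_cases htwo : ∃ c, f c = 2
  · obtain ⟨c, hc⟩ := htwo
    rw [Finset.sum_eq_single c (fun c' _ hc' => hA c c' (Ne.symm hc') hc) (fun h => absurd (Finset.mem_univ c) h), hc]
  · push Not at htwo
    have h1 : ∀ c, f c ≤ 1 := fun c => by have := h2 c; have := htwo c; omega
    have hf : ∀ c, f c = if f c = 1 then 1 else 0 := by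
      intro c; have := h1 c; split_ifs with h <;> omega
    rw [Finset.sum_congr rfl (fun c _ => hf c), Finset.sum_boole, Nat.cast_id]
    by_contra hgt
    push Not at hgt
    obtain ⟨T, hT, hTcard⟩ := Finset.exists_subset_card_eq (show 3 ≤ (univ.filter fun c => f c = 1).card by omega)
    let e : Fin 3 ↪o Fin C := T.orderEmbOfFin hTcard
    have he : ∀ i, f (e i) = 1 := fun i => (Finset.mem_filter.mp (hT (Finset.orderEmbOfFin_mem T hTcard i))).2
    exact hB (e 0) (e 1) (e 2) (e.strictMono (by decide)) (e.strictMono (by decide)) (he 0) (he 1) (he 2)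

/-! ## 2. Sidon bookkeeping at a generic Weyl face (positions `0, 5`) -/

/-- At a generic Weyl face, `δ0 q' = δ0 q` for positions `q, q' ≠ 5` forces `q' = q`. [folklore] -/
theorem weyl_pos_inj (δ0 : Fin 6 → ℝ)
    (hsid : ∀ a b c d : Fin 5, δ0 a.castSucc + δ0 b.castSucc = δ0 c.castSucc + δ0 d.castSucc → (a = c ∧ b = d) ∨ (a = d ∧ b = c))
    (q q' : Fin 6) (hq : q ≠ 5) (hq' : q' ≠ 5) (h : δ0 q' = δ0 q) : q' = q := by
  obtain ⟨m, rfl⟩ := Fin.exists_castSucc_eq.mpr hq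
  obtain ⟨m', rfl⟩ := Fin.exists_castSucc_eq.mpr hq'
  rcases hsid m' m' m m (by rw [h]) with ⟨h1, -⟩ | ⟨h1, -⟩ <;> rw [h1]

/-- At a generic Weyl face, a confluent member `(5, q')` (`q' ≠ 5`) never shares its value with a member `(p, q)` avoiding the Weyl positions. [folklore] -/
theorem weyl_singleton_value (δ0 : Fin 6 → ℝ) (h05 : δ0 5 = δ0 0)
    (hsid : ∀ a b c d : Fin 5, δ0 a.castSucc + δ0 b.castSucc = δ0 c.castSucc + δ0 d.castSucc → (a = c ∧ b = d) ∨ (a = d ∧ b = c))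
    (p q q' : Fin 6) (hp0 : p ≠ 0) (hp5 : p ≠ 5) (hq0 : q ≠ 0) (hq5 : q ≠ 5) (hq' : q' ≠ 5)
    (h : δ0 5 + δ0 q' = δ0 p + δ0 q) : False := by
  obtain ⟨mp, rfl⟩ := Fin.exists_castSucc_eq.mpr hp5
  obtain ⟨mq, rfl⟩ := Fin.exists_castSucc_eq.mpr hq5
  obtain ⟨m', rfl⟩ := Fin.exists_castSucc_eq.mpr hq'
  rw [h05, show (0 : Fin 6) = (0 : Fin 5).castSucc from rfl] at h
  rcases hsid 0 m' mp mq h with ⟨h1, -⟩ | ⟨h1, -⟩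
  · exact hp0 (by rw [← h1]; rfl)
  · exact hq0 (by rw [← h1]; rfl)

/-- At a generic Weyl face, the triple value `2δ0 0` is not a member value `δ0 p + δ0 q` with `q` off the Weyl positions. [folklore] -/
theorem weyl_triple_value (δ0 : Fin 6 → ℝ) (h05 : δ0 5 = δ0 0)
    (hsid : ∀ a b c d : Fin 5, δ0 a.castSucc + δ0 b.castSucc = δ0 c.castSucc + δ0 d.castSucc → (a = c ∧ b = d) ∨ (a = d ∧ b = c))
    (p q : Fin 6) (hq0 : q ≠ 0) (hq5 : q ≠ 5) (h : δ0 0 + δ0 0 = δ0 p + δ0 q) : False := by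
  -- reduce `p` to a non-`5` position with the same exponent
  have hp' : ∃ p' : Fin 6, p' ≠ 5 ∧ δ0 p' = δ0 p := by
    by_cases hp : p = 5
    · exact ⟨0, by decide, by rw [hp, h05]⟩
    · exact ⟨p, hp, rfl⟩
  obtain ⟨p', hp'5, hp'eq⟩ := hp'
  obtain ⟨mp, rfl⟩ := Fin.exists_castSucc_eq.mpr hp'5
  obtain ⟨mq, rfl⟩ := Fin.exists_castSucc_eq.mpr hq5
  rw [← hp'eq, show (0 : Fin 6) = (0 : Fin 5).castSucc from rfl] at h
  rcases hsid 0 0 mp mq h with ⟨-, h1⟩ | ⟨h1, -⟩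
  · exact hq0 (by rw [← h1]; rfl)
  · exact hq0 (by rw [← h1]; rfl)

end Summit.ValiantsHypothesis.ValiantsHypothesis.Theorems.LacunarySymmetroidMatrixDescartes.WallBubbling
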